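import Summits.AtomisticToContinuum.HydrodynamicLimit.Theses.StiffCollisionalRelaxation
import Summits.AtomisticToContinuum.HydrodynamicLimit.Theses.CollisionIsometryCLT
import Summits.AtomisticToContinuum.HydrodynamicLimit.Statement
import Summits.AtomisticToContinuum.HydrodynamicLimit.Theorems.StiffCollisionalRelaxationAprioriBoundsFibreDefsR4
import Summits.AtomisticToContinuum.HydrodynamicLimit.Theorems.StiffCollisionalRelaxationAprioriBoundsFibreReduction
import Summits.AtomisticToContinuum.HydrodynamicLimit.Theorems.StiffCollisionalRelaxationAprioriBoundsFibreEnergyMoment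
import Summits.AtomisticToContinuum.HydrodynamicLimit.Theorems.StiffCollisionalRelaxationAprioriBoundsFibrePartOnePrime
import Summits.AtomisticToContinuum.HydrodynamicLimit.Theorems.StiffCollisionalRelaxationAprioriBoundsFibreKLLever
import Summits.AtomisticToContinuum.HydrodynamicLimit.Theorems.StiffCollisionalRelaxationAprioriBoundsFibreKLTransfer
import Summits.AtomisticToContinuum.HydrodynamicLimit.Theorems.StiffCollisionalRelaxationAprioriBoundsFibreBracketVanish
import Summits.AtomisticToContinuum.HydrodynamicLimit.Theorems.StiffCollisionalRelaxationAprioriBoundsFibreFarTailAll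
import Summits.AtomisticToContinuum.HydrodynamicLimit.Theorems.StiffCollisionalRelaxationAprioriBoundsFibreLinStatL1OfHydroLimit
import Summits.AtomisticToContinuum.HydrodynamicLimit.Theorems.StiffCollisionalRelaxationAprioriBoundsPartTwoOfKineticRangeControl
import Literature.MathematicalPhysics.KineticTheory.HardSphereEulerSolutionGluing
import Summits.AtomisticToContinuum.HydrodynamicLimit.Theses.ImplosionDichotomy
import HarnessLib

/-!
# Capstones of the line `fibre-deficit-transfer` (crux `AprioriBounds`, stmt-AtomisticToContinuum-14827)

Support file (`--supports stmt-AtomisticToContinuum-14827`) of the lead prover of the line.  With every PRIVATE stub of the rate-free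
skeleton r4/r5 landed (`stub_energyMoment`, `stub_bracketVanish`, `stub_klLever`, `stub_partOnePrime`; glue `farTailAll_of_gaussianVelocityTails`,
`linStatL1_of_hydroLimitOn_Ico`, `partTwo_of_kineticRangeControl`), the crux decl
`StiffCollisionalRelaxation.AprioriBounds` (= `CollisionIsometryCLT.AprioriBoundsPreShock`) follows from EXISTING statements only:

* `stub_linStatL1_of_hydrodynamicLimit` (LANDED, …FibreLinStatL1OfHydroLimit) — the conjunct Statement `_root_.HydrodynamicLimit` gives the r4 input `stub_linStatL1` (hydrodynamics in the
  mean on `[0,t]`): restrict the classical solution to `[0,t)` (`IsHardSphereEulerSolution.restrict`), read the Statement's packing guard off the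
  crux's dilute premise (`η₁ := min (2η₀) η_e`), and use the a.e.-glue (the endpoint `s = t` is Lebesgue-null);
* `AprioriBounds_of_KRC_GVT_HL : KineticRangeControl → GaussianVelocityTails → HydrodynamicLimit → AprioriBounds` (registered sub-goal) and its
  `AprioriBoundsPreShock` twin — for the two routes wanting the crux as an INPUT to the conjunct the third hypothesis is circular; the theorem
  certifies that component (i) carries no difficulty beyond the conjunct on `[0,t)` and the velocity-tail item 9633;
* `AprioriBounds_of_KRC_GVT_IREV` — the same with, in place of the conjunct, ANY time-integrated relative-entropy hydrodynamics on `[0,t]`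
  (`∃` slice-continuous positive activity field `b` with `KLIntegratedVanishAt σ a₀ θ₀ u₀ b θ u Φ t`; the dock for the `RelEntropyVanishing`
  family restated on `[0,t]`), through the landed `integratedBulkTail_of_klDiv_integrated` — no statics, no hydrodynamic glue.

No new definitions; no `sorry`; axioms `propext`, `Classical.choice`, `Quot.sound`.
-/

noncomputable section

open MeasureTheory Filter Set Topology
open scoped ENNReal

namespace Summit.AtomisticToContinuum.HydrodynamicLimit.Theorems.FibreDeficitTransfer

open Literature.MathematicalPhysics.KineticTheory Literature.Analysis.FluidPDE
open Summit.AtomisticToContinuum.HydrodynamicLimit.Theorems.AprioriBoundsNegative (PartOneAt PartTwoAt)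
open Summit.AtomisticToContinuum.HydrodynamicLimit.Theorems.VisitLedgerUpscattering (Cfg Flow Flows NiceProfiles)

/-- **Component (i) under the crux prefix from the conjunct and 9633** (the rate-free chain with every private stub landed):
`stub_linStatL1` from `HydrodynamicLimit`, `stub_bracketVanish`, `stub_klLever`, `farTailAll_of_gaussianVelocityTails`, `stub_partOnePrime`. -/
theorem partOne_of_GVT_HL
    (hGVT : Summit.AtomisticToContinuum.HydrodynamicLimit.Theses.SpeedCapSurgery.GaussianVelocityTails)
    (hHL : _root_.HydrodynamicLimit) :
    ∀ (a₀ θ₀ : T3 → ℝ) (u₀ : T3 → V3), Continuous a₀ → Continuous θ₀ → Continuous u₀ →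
      (∀ x, 0 < a₀ x) → (∀ x, 0 < θ₀ x) →
      ∃ σ₀ : ℝ, 0 < σ₀ ∧ ∃ η₁ : ℝ, 0 < η₁ ∧ ∀ σ : ℝ, 0 < σ → σ < σ₀ →
        ∀ (T : ℝ) (ρ θ : ℝ → T3 → ℝ) (u : ℝ → T3 → V3), IsHardSphereEulerSolution σ T ρ u θ →
        ∀ Φ : (N : ℕ) → HardSphereFlow (Torus.geometry (Fin 3)) (hsDiameter σ N) (N + 1),
          TendstoHydroFieldsAt (fun N => localGibbsLaw σ a₀ u₀ θ₀ N (Φ N)) Φ ρ u θ 0 →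
          ∀ t : ℝ, 0 < t → t < T → (∀ s ∈ Icc 0 t, ∀ x, 2 * ρ s x * σ ^ 3 < η₁) →
            PartOneAt σ a₀ θ₀ u₀ Φ t := by
  intro a₀ θ₀ u₀ ha hθ hu ha0 hθ0
  have hP : NiceProfiles a₀ θ₀ u₀ := ⟨ha, hθ, hu, ha0, hθ0⟩
  obtain ⟨σ₁, hσ₁, η₁', hη₁', H1⟩ := stub_linStatL1_of_hydrodynamicLimit hHL a₀ θ₀ u₀ ha hθ hu ha0 hθ0
  obtain ⟨σ₃, hσ₃, η₃', hη₃', H3⟩ := stub_bracketVanish a₀ θ₀ u₀ ha hθ hu ha0 hθ0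
  obtain ⟨σ₄, hσ₄, η₄', hη₄', H4⟩ := farTailAll_of_gaussianVelocityTails hGVT a₀ θ₀ u₀ ha hθ hu ha0 hθ0
  obtain ⟨ηe, hηe, hfe, hdfe⟩ := eos_continuousOn
  refine ⟨min (min σ₁ σ₃) (min σ₄ (1 / 2)), lt_min (lt_min hσ₁ hσ₃) (lt_min hσ₄ one_half_pos),
    min (min η₁' η₃') (min η₄' ηe), lt_min (lt_min hη₁' hη₃') (lt_min hη₄' hηe), ?_⟩
  intro σ hσ hσlt T ρ θ u hsol Φ hLLN t ht htT hdil
  simp only [lt_min_iff] at hσlt hdil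
  obtain ⟨⟨hs1, hs3⟩, hs4, hshalf⟩ := hσlt
  have hLin : LinStatL1VanishAt σ a₀ θ₀ u₀ ρ θ u Φ t :=
    H1 σ hσ hs1 T ρ θ u hsol Φ hLLN t ht htT (fun s hs x => (hdil s hs x).1.1)
  have hBr : BracketIntegratedVanishAt σ a₀ θ₀ u₀ ρ θ u t :=
    H3 σ hσ hs3 T ρ θ u hsol Φ hLLN t ht htT (fun s hs x => (hdil s hs x).1.2)
  have hFar : FarTailAllAt σ a₀ θ₀ u₀ Φ t :=
    H4 σ hσ hs4 T ρ θ u hsol Φ hLLN t ht htT (fun s hs x => (hdil s hs x).2.1)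
  obtain ⟨hρc, hθc, huc, hθpos, hρpos⟩ := fields_continuousOn hsol htT
  have hcham : ∀ s ∈ Icc 0 t, ∀ x, ρ s x * σ ^ 3 < ηe := fun s hs x => by
    have h := (hdil s hs x).2.2
    have h0 : 0 < ρ s x * σ ^ 3 := mul_pos (hρpos s hs x) (pow_pos hσ 3)
    linarith
  have hΛ := lam0_continuousOn hσ hfe hdfe hρc hθc huc hρpos hθpos hcham
  have hBulk : IntegratedBulkTailAt σ a₀ θ₀ u₀ Φ t :=
    stub_klLever σ a₀ θ₀ u₀ ρ θ u Φ t hσ hshalf hP ht hρc hθc huc hθpos hΛ hBr hLin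
  exact stub_partOnePrime σ a₀ θ₀ u₀ Φ t hσ hshalf.le hP ht hBulk hFar

/-- **CAPSTONE 1 (registered sub-goal `AprioriBounds_of_KRC_GVT_HL`) — the crux from three existing statements, every ingredient of the
line PROVED**: `KineticRangeControl` (stmt-9201, component (ii) via `partTwo_of_kineticRangeControl`), `GaussianVelocityTails` (stmt-9633, far tails)
and the conjunct `HydrodynamicLimit` (hydrodynamics in the mean on `[0,t)`).  HONEST READING: for the routes that want the crux as an input to the
conjunct the third hypothesis is circular; what the kernel certifies is that the pre-shock bound (i) is no harder than the conjunct on `[0,t)` plus 9633. -/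
theorem AprioriBounds_of_KRC_GVT_HL : Summit.AtomisticToContinuum.HydrodynamicLimit.Theses.GermanoSplitLES.KineticRangeControl → Summit.AtomisticToContinuum.HydrodynamicLimit.Theses.SpeedCapSurgery.GaussianVelocityTails → _root_.HydrodynamicLimit → Summit.AtomisticToContinuum.HydrodynamicLimit.Theses.StiffCollisionalRelaxation.AprioriBounds := by
  intro hKRC hGVT hHL
  rw [Theorems.AprioriBoundsNegative.aprioriBounds_iff]
  intro a₀ θ₀ u₀ ha hθ hu ha0 hθ0
  obtain ⟨σ₁, hσ₁, η₁', hη₁', HI⟩ := partOne_of_GVT_HL hGVT hHL a₀ θ₀ u₀ ha hθ hu ha0 hθ0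
  obtain ⟨σ₂, hσ₂, η₂', hη₂', HII⟩ := AdiabatCeiling.partTwo_of_kineticRangeControl hKRC a₀ θ₀ u₀ ha hθ hu ha0 hθ0
  refine ⟨min σ₁ σ₂, lt_min hσ₁ hσ₂, min η₁' η₂', lt_min hη₁' hη₂', ?_⟩
  intro σ hσ hσlt T ρ θ u hsol Φ hLLN t ht htT hdil
  simp only [lt_min_iff] at hσlt hdil
  exact ⟨HI σ hσ hσlt.1 T ρ θ u hsol Φ hLLN t ht htT (fun s hs x => (hdil s hs x).1),
    HII σ hσ hσlt.2 T ρ θ u hsol Φ hLLN t ht htT (fun s hs x => (hdil s hs x).2)⟩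

/-- The `CollisionIsometryCLT` twin of `AprioriBounds_of_KRC_GVT_HL` (the two route decls are one `Prop`). -/
theorem AprioriBoundsPreShock_of_KRC_GVT_HL :
    Summit.AtomisticToContinuum.HydrodynamicLimit.Theses.GermanoSplitLES.KineticRangeControl →
    Summit.AtomisticToContinuum.HydrodynamicLimit.Theses.SpeedCapSurgery.GaussianVelocityTails →
    _root_.HydrodynamicLimit →
    Summit.AtomisticToContinuum.HydrodynamicLimit.Theses.CollisionIsometryCLT.AprioriBoundsPreShock :=
  AprioriBounds_of_KRC_GVT_HL

/-- **CAPSTONE 2 — the crux from 9201, 9633 and ANY time-integrated relative-entropy hydrodynamics on `[0,t]`** (the dock for the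
`RelEntropyVanishing` family / `KnudsenRateHorizon.EntropyKnudsenRate`, restated on `[0,t]` with a slice-continuous positive activity field `b`:
`∫₀ᵗ H(μ_s^N ‖ localGibbs(b_s, u_s, θ_s)) ds = o(N)`, i.e. `KLIntegratedVanishAt σ a₀ θ₀ u₀ b θ u Φ t`).  Component (i) then needs neither the
statics nor the hydrodynamic glue: `integratedBulkTail_of_klDiv_integrated` + `farTailAll_of_gaussianVelocityTails` + `stub_partOnePrime`. -/
theorem AprioriBounds_of_KRC_GVT_IREV
    (hKRC : Summit.AtomisticToContinuum.HydrodynamicLimit.Theses.GermanoSplitLES.KineticRangeControl)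
    (hGVT : Summit.AtomisticToContinuum.HydrodynamicLimit.Theses.SpeedCapSurgery.GaussianVelocityTails)
    (hREV : ∀ (a₀ θ₀ : T3 → ℝ) (u₀ : T3 → V3), Continuous a₀ → Continuous θ₀ → Continuous u₀ →
      (∀ x, 0 < a₀ x) → (∀ x, 0 < θ₀ x) →
      ∃ σ₀ : ℝ, 0 < σ₀ ∧ ∃ η₁ : ℝ, 0 < η₁ ∧ ∀ σ : ℝ, 0 < σ → σ < σ₀ →
        ∀ (T : ℝ) (ρ θ : ℝ → T3 → ℝ) (u : ℝ → T3 → V3), IsHardSphereEulerSolution σ T ρ u θ →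
        ∀ Φ : (N : ℕ) → HardSphereFlow (Torus.geometry (Fin 3)) (hsDiameter σ N) (N + 1),
          TendstoHydroFieldsAt (fun N => localGibbsLaw σ a₀ u₀ θ₀ N (Φ N)) Φ ρ u θ 0 →
          ∀ t : ℝ, 0 < t → t < T → (∀ s ∈ Icc 0 t, ∀ x, 2 * ρ s x * σ ^ 3 < η₁) →
            ∃ b : ℝ → T3 → ℝ, (∀ s ∈ Icc 0 t, Continuous (b s)) ∧ (∀ s ∈ Icc 0 t, ∀ x, 0 < b s x) ∧
              KLIntegratedVanishAt σ a₀ θ₀ u₀ b θ u Φ t) :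
    Summit.AtomisticToContinuum.HydrodynamicLimit.Theses.StiffCollisionalRelaxation.AprioriBounds := by
  rw [Theorems.AprioriBoundsNegative.aprioriBounds_iff]
  intro a₀ θ₀ u₀ ha hθ hu ha0 hθ0
  have hP : NiceProfiles a₀ θ₀ u₀ := ⟨ha, hθ, hu, ha0, hθ0⟩
  obtain ⟨σ₁, hσ₁, η₁', hη₁', H1⟩ := hREV a₀ θ₀ u₀ ha hθ hu ha0 hθ0
  obtain ⟨σ₂, hσ₂, η₂', hη₂', H2⟩ := AdiabatCeiling.partTwo_of_kineticRangeControl hKRC a₀ θ₀ u₀ ha hθ hu ha0 hθ0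
  obtain ⟨σ₄, hσ₄, η₄', hη₄', H4⟩ := farTailAll_of_gaussianVelocityTails hGVT a₀ θ₀ u₀ ha hθ hu ha0 hθ0
  refine ⟨min (min σ₁ σ₂) (min σ₄ (1 / 2)), lt_min (lt_min hσ₁ hσ₂) (lt_min hσ₄ one_half_pos),
    min (min η₁' η₂') η₄', lt_min (lt_min hη₁' hη₂') hη₄', ?_⟩
  intro σ hσ hσlt T ρ θ u hsol Φ hLLN t ht htT hdil
  simp only [lt_min_iff] at hσlt hdil
  obtain ⟨⟨hs1, hs2⟩, hs4, hshalf⟩ := hσlt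
  obtain ⟨b, hbc, hb0, hKL⟩ := H1 σ hσ hs1 T ρ θ u hsol Φ hLLN t ht htT (fun s hs x => (hdil s hs x).1.1)
  have hFar : FarTailAllAt σ a₀ θ₀ u₀ Φ t := H4 σ hσ hs4 T ρ θ u hsol Φ hLLN t ht htT (fun s hs x => (hdil s hs x).2)
  obtain ⟨-, hθc, huc, hθpos, -⟩ := fields_continuousOn hsol htT
  have hBulk : IntegratedBulkTailAt σ a₀ θ₀ u₀ Φ t :=
    integratedBulkTail_of_klDiv_integrated σ a₀ θ₀ u₀ b θ u Φ t hσ hshalf hP ht hθc huc hθpos hbc hb0 hKL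
  exact ⟨stub_partOnePrime σ a₀ θ₀ u₀ Φ t hσ hshalf.le hP ht hBulk hFar,
    H2 σ hσ hs2 T ρ θ u hsol Φ hLLN t ht htT (fun s hs x => (hdil s hs x).1.2)⟩

/-- The `CollisionIsometryCLT` twin of `AprioriBounds_of_KRC_GVT_IREV`. -/
theorem AprioriBoundsPreShock_of_KRC_GVT_IREV
    (hKRC : Summit.AtomisticToContinuum.HydrodynamicLimit.Theses.GermanoSplitLES.KineticRangeControl)
    (hGVT : Summit.AtomisticToContinuum.HydrodynamicLimit.Theses.SpeedCapSurgery.GaussianVelocityTails)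
    (hREV : ∀ (a₀ θ₀ : T3 → ℝ) (u₀ : T3 → V3), Continuous a₀ → Continuous θ₀ → Continuous u₀ →
      (∀ x, 0 < a₀ x) → (∀ x, 0 < θ₀ x) →
      ∃ σ₀ : ℝ, 0 < σ₀ ∧ ∃ η₁ : ℝ, 0 < η₁ ∧ ∀ σ : ℝ, 0 < σ → σ < σ₀ →
        ∀ (T : ℝ) (ρ θ : ℝ → T3 → ℝ) (u : ℝ → T3 → V3), IsHardSphereEulerSolution σ T ρ u θ →
        ∀ Φ : (N : ℕ) → HardSphereFlow (Torus.geometry (Fin 3)) (hsDiameter σ N) (N + 1),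
          TendstoHydroFieldsAt (fun N => localGibbsLaw σ a₀ u₀ θ₀ N (Φ N)) Φ ρ u θ 0 →
          ∀ t : ℝ, 0 < t → t < T → (∀ s ∈ Icc 0 t, ∀ x, 2 * ρ s x * σ ^ 3 < η₁) →
            ∃ b : ℝ → T3 → ℝ, (∀ s ∈ Icc 0 t, Continuous (b s)) ∧ (∀ s ∈ Icc 0 t, ∀ x, 0 < b s x) ∧
              KLIntegratedVanishAt σ a₀ θ₀ u₀ b θ u Φ t) :
    Summit.AtomisticToContinuum.HydrodynamicLimit.Theses.CollisionIsometryCLT.AprioriBoundsPreShock :=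
  AprioriBounds_of_KRC_GVT_IREV hKRC hGVT hREV

/-! ## Appended (lead a1, cycle 1): the sharper capstone — the PROFILE-WISE guarded conjunct suffices -/

/-- **Component (i) under the crux prefix from 9633 and the profile-wise guarded conjunct `HydroLimitProfilewiseBand` (stmt-17372)** —
as `partOne_of_GVT_HL` with the landed `stub_linStatL1_of_hydroLimitProfilewiseBand` in place of `stub_linStatL1_of_hydrodynamicLimit`. -/
theorem partOne_of_GVT_HLPB
    (hGVT : Summit.AtomisticToContinuum.HydrodynamicLimit.Theses.SpeedCapSurgery.GaussianVelocityTails)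
    (hHL : Summit.AtomisticToContinuum.HydrodynamicLimit.Theses.ImplosionDichotomy.HydroLimitProfilewiseBand) :
    ∀ (a₀ θ₀ : T3 → ℝ) (u₀ : T3 → V3), Continuous a₀ → Continuous θ₀ → Continuous u₀ →
      (∀ x, 0 < a₀ x) → (∀ x, 0 < θ₀ x) →
      ∃ σ₀ : ℝ, 0 < σ₀ ∧ ∃ η₁ : ℝ, 0 < η₁ ∧ ∀ σ : ℝ, 0 < σ → σ < σ₀ →
        ∀ (T : ℝ) (ρ θ : ℝ → T3 → ℝ) (u : ℝ → T3 → V3), IsHardSphereEulerSolution σ T ρ u θ →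
        ∀ Φ : (N : ℕ) → HardSphereFlow (Torus.geometry (Fin 3)) (hsDiameter σ N) (N + 1),
          TendstoHydroFieldsAt (fun N => localGibbsLaw σ a₀ u₀ θ₀ N (Φ N)) Φ ρ u θ 0 →
          ∀ t : ℝ, 0 < t → t < T → (∀ s ∈ Icc 0 t, ∀ x, 2 * ρ s x * σ ^ 3 < η₁) →
            PartOneAt σ a₀ θ₀ u₀ Φ t := by
  intro a₀ θ₀ u₀ ha hθ hu ha0 hθ0
  have hP : NiceProfiles a₀ θ₀ u₀ := ⟨ha, hθ, hu, ha0, hθ0⟩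
  obtain ⟨σ₁, hσ₁, η₁', hη₁', H1⟩ := stub_linStatL1_of_hydroLimitProfilewiseBand hHL a₀ θ₀ u₀ ha hθ hu ha0 hθ0
  obtain ⟨σ₃, hσ₃, η₃', hη₃', H3⟩ := stub_bracketVanish a₀ θ₀ u₀ ha hθ hu ha0 hθ0
  obtain ⟨σ₄, hσ₄, η₄', hη₄', H4⟩ := farTailAll_of_gaussianVelocityTails hGVT a₀ θ₀ u₀ ha hθ hu ha0 hθ0
  obtain ⟨ηe, hηe, hfe, hdfe⟩ := eos_continuousOn
  refine ⟨min (min σ₁ σ₃) (min σ₄ (1 / 2)), lt_min (lt_min hσ₁ hσ₃) (lt_min hσ₄ one_half_pos),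
    min (min η₁' η₃') (min η₄' ηe), lt_min (lt_min hη₁' hη₃') (lt_min hη₄' hηe), ?_⟩
  intro σ hσ hσlt T ρ θ u hsol Φ hLLN t ht htT hdil
  simp only [lt_min_iff] at hσlt hdil
  obtain ⟨⟨hs1, hs3⟩, hs4, hshalf⟩ := hσlt
  have hLin : LinStatL1VanishAt σ a₀ θ₀ u₀ ρ θ u Φ t :=
    H1 σ hσ hs1 T ρ θ u hsol Φ hLLN t ht htT (fun s hs x => (hdil s hs x).1.1)
  have hBr : BracketIntegratedVanishAt σ a₀ θ₀ u₀ ρ θ u t :=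
    H3 σ hσ hs3 T ρ θ u hsol Φ hLLN t ht htT (fun s hs x => (hdil s hs x).1.2)
  have hFar : FarTailAllAt σ a₀ θ₀ u₀ Φ t :=
    H4 σ hσ hs4 T ρ θ u hsol Φ hLLN t ht htT (fun s hs x => (hdil s hs x).2.1)
  obtain ⟨hρc, hθc, huc, hθpos, hρpos⟩ := fields_continuousOn hsol htT
  have hcham : ∀ s ∈ Icc 0 t, ∀ x, ρ s x * σ ^ 3 < ηe := fun s hs x => by
    have h := (hdil s hs x).2.2
    have h0 : 0 < ρ s x * σ ^ 3 := mul_pos (hρpos s hs x) (pow_pos hσ 3)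
    linarith
  have hΛ := lam0_continuousOn hσ hfe hdfe hρc hθc huc hρpos hθpos hcham
  have hBulk : IntegratedBulkTailAt σ a₀ θ₀ u₀ Φ t :=
    stub_klLever σ a₀ θ₀ u₀ ρ θ u Φ t hσ hshalf hP ht hρc hθc huc hθpos hΛ hBr hLin
  exact stub_partOnePrime σ a₀ θ₀ u₀ Φ t hσ hshalf.le hP ht hBulk hFar

/-- **CAPSTONE 1′ (registered sub-goal `AprioriBounds_of_KRC_GVT_HLPB`) — the crux from 9201, 9633 and the PROFILE-WISE guarded conjunct
`ImplosionDichotomy.HydroLimitProfilewiseBand` (stmt-17372; `∀ profiles ∃ η`, weaker than the Statement and the natural output of every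
perturbative engine).**  This is the sharpest existing-item reduction the line delivers. -/
theorem AprioriBounds_of_KRC_GVT_HLPB : Summit.AtomisticToContinuum.HydrodynamicLimit.Theses.GermanoSplitLES.KineticRangeControl → Summit.AtomisticToContinuum.HydrodynamicLimit.Theses.SpeedCapSurgery.GaussianVelocityTails → Summit.AtomisticToContinuum.HydrodynamicLimit.Theses.ImplosionDichotomy.HydroLimitProfilewiseBand → Summit.AtomisticToContinuum.HydrodynamicLimit.Theses.StiffCollisionalRelaxation.AprioriBounds := by
  intro hKRC hGVT hHL
  rw [Theorems.AprioriBoundsNegative.aprioriBounds_iff]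
  intro a₀ θ₀ u₀ ha hθ hu ha0 hθ0
  obtain ⟨σ₁, hσ₁, η₁', hη₁', HI⟩ := partOne_of_GVT_HLPB hGVT hHL a₀ θ₀ u₀ ha hθ hu ha0 hθ0
  obtain ⟨σ₂, hσ₂, η₂', hη₂', HII⟩ := AdiabatCeiling.partTwo_of_kineticRangeControl hKRC a₀ θ₀ u₀ ha hθ hu ha0 hθ0
  refine ⟨min σ₁ σ₂, lt_min hσ₁ hσ₂, min η₁' η₂', lt_min hη₁' hη₂', ?_⟩
  intro σ hσ hσlt T ρ θ u hsol Φ hLLN t ht htT hdil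
  simp only [lt_min_iff] at hσlt hdil
  exact ⟨HI σ hσ hσlt.1 T ρ θ u hsol Φ hLLN t ht htT (fun s hs x => (hdil s hs x).1),
    HII σ hσ hσlt.2 T ρ θ u hsol Φ hLLN t ht htT (fun s hs x => (hdil s hs x).2)⟩

/-- The `CollisionIsometryCLT` twin of `AprioriBounds_of_KRC_GVT_HLPB`. -/
theorem AprioriBoundsPreShock_of_KRC_GVT_HLPB :
    Summit.AtomisticToContinuum.HydrodynamicLimit.Theses.GermanoSplitLES.KineticRangeControl →
    Summit.AtomisticToContinuum.HydrodynamicLimit.Theses.SpeedCapSurgery.GaussianVelocityTails →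
    Summit.AtomisticToContinuum.HydrodynamicLimit.Theses.ImplosionDichotomy.HydroLimitProfilewiseBand →
    Summit.AtomisticToContinuum.HydrodynamicLimit.Theses.CollisionIsometryCLT.AprioriBoundsPreShock :=
  AprioriBounds_of_KRC_GVT_HLPB

end Summit.AtomisticToContinuum.HydrodynamicLimit.Theorems.FibreDeficitTransfer

end
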